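import Mathlib

/-!
# `SystemLSDRealSegment` — negative-side support: the forced beyond-level constant and the Type-I share

Consistency / tightness lemmas for the crux `Summit.Parity.BatemanHorn.Theses.AlmostPrimeZeros.SystemLSDRealSegment`
(stmt-Parity-11292), from the standing disprover's work file `Cruxes/SystemLSDRealSegment/Disproof.lean` §7.2 (gen 3).

Every anatomy line for the crux (`Lines/beta-thinned-root-kernel`, `sign-free-sieve-lab`, `ewens-pd-kernel`) splits the
tilted sum `Σ_{n≤x} y^{s_f(n)}` into a level-`≤ x` (Type-I, theorem-grade) part with constant `λ_f(y)/Γ(k(y-1)+1)` and a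
beyond-level kernel whose constant is FORCED to be `λ_f(y)·(D^{y-1}Γ(y)^{-k} - Γ(k(y-1)+1)^{-1})`, `D = ∏ deg fᵢ`, by the
crux's prediction `λ_f(y) D^{y-1} Γ(y)^{-k}`. Since the kernel is a sum of non-negative terms, a NEGATIVE forced constant
would refute the crux outright. It is not: by the log-convexity of `Γ` (Bohr–Mollerup, `Real.convexOn_log_Gamma`)
`Γ(1+u)^k ≤ Γ(1+ku)`, so the constant is `≥ 0` for every `k`, real `D ≥ 1`, `y > 1` (`betaKernelConst_nonneg`), and
`> 0` as soon as `D > 1` (`betaKernelConst_pos_of_one_lt`). Equivalently the Type-I share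
`Γ(k(y-1)+1)^{-1}/(D^{y-1}Γ(y)^{-k})` of the predicted mass is `≤ 1`, and `< 1` whenever some member is non-linear
(`typeIShare_le_one`, `typeIShare_lt_one`; e.g. `2^{1-y} ≈ 71 %` for `X²+1` at `y = 3/2`): no line avoids the divisor
data of `fᵢ(n)` beyond level `x` — the crux's Type-I₂ wall as a Lean inequality. (For `D = 1`, `k ≥ 2` — prime tuples —
strictness is STRICT log-convexity of `Γ`, numerically `Γ(3/2)^{-2} - Γ(2)^{-1} = 0.2732`; not formalised here.)
The real form `e^{(y-1) log D}(Γ(y)⁻¹)^k` of the archimedean factor is the one of the lines (`archFactor`).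
-/

namespace Summit.Parity.BatemanHorn.Theorems.SystemLSDRealSegment.Negative

/-- Log-convexity of `Γ` (Bohr–Mollerup): `Γ(1+u)^k ≤ Γ(1+ku)` for `u ≥ 0`, `k ≥ 1`. [folklore] -/
theorem Gamma_one_add_pow_le (k : ℕ) (hk : 1 ≤ k) {u : ℝ} (hu : 0 ≤ u) :
    Real.Gamma (1 + u) ^ k ≤ Real.Gamma (1 + k * u) := by
  have hk0 : (0 : ℝ) < k := by exact_mod_cast hk
  have hconv := Real.convexOn_log_Gamma
  have h1 : (1 : ℝ) ∈ Set.Ioi (0 : ℝ) := by simp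
  have h2 : (1 + (k : ℝ) * u) ∈ Set.Ioi (0 : ℝ) := by
    simp only [Set.mem_Ioi]; positivity
  have ha : (0 : ℝ) ≤ 1 - 1 / k := by
    rw [sub_nonneg, div_le_one hk0]; exact_mod_cast hk
  have hb : (0 : ℝ) ≤ 1 / k := by positivity
  have hab : 1 - 1 / (k : ℝ) + 1 / k = 1 := by ring
  have key := hconv.2 h1 h2 ha hb hab
  simp only [Function.comp_apply, smul_eq_mul, Real.Gamma_one, Real.log_one, mul_zero, zero_add] at key
  have hpt : (1 - 1 / (k : ℝ)) * 1 + 1 / k * (1 + k * u) = 1 + u := by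
    field_simp; ring
  rw [hpt] at key
  have hG1 : 0 < Real.Gamma (1 + u) := Real.Gamma_pos_of_pos (by linarith)
  have hG2 : 0 < Real.Gamma (1 + k * u) := Real.Gamma_pos_of_pos (by positivity)
  have key' : (k : ℝ) * Real.log (Real.Gamma (1 + u)) ≤ Real.log (Real.Gamma (1 + k * u)) := by
    have := mul_le_mul_of_nonneg_left key hk0.le
    rwa [← mul_assoc, mul_one_div_cancel hk0.ne', one_mul] at this
  rw [← Real.log_pow] at key'
  exact (Real.log_le_log_iff (pow_pos hG1 k) hG2).1 key'

/-- CONSISTENCY OF THE FORCED KERNEL CONSTANT: `Γ(k(y-1)+1)⁻¹ ≤ e^{(y-1) log D}(Γ(y)⁻¹)^k` for every `k`, real `D ≥ 1`,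
`y > 1` — the beyond-level constant `λ_f(y)(D^{y-1}Γ(y)^{-k} - Γ(k(y-1)+1)^{-1})` is `≥ 0`, as a limit of non-negative
sums must be. No sign refutation of the kernel stubs. [folklore] -/
theorem betaKernelConst_nonneg (k : ℕ) {D y : ℝ} (hD : 1 ≤ D) (hy : 1 < y) :
    (Real.Gamma (k * (y - 1) + 1))⁻¹ ≤ Real.exp ((y - 1) * Real.log D) * (Real.Gamma y)⁻¹ ^ k := by
  have hGy : 0 < Real.Gamma y := Real.Gamma_pos_of_pos (by linarith)
  have hexp : 1 ≤ Real.exp ((y - 1) * Real.log D) :=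
    Real.one_le_exp (mul_nonneg (by linarith) (Real.log_nonneg hD))
  rcases Nat.eq_zero_or_pos k with rfl | hk
  · simp only [Nat.cast_zero, zero_mul, zero_add, Real.Gamma_one, inv_one, pow_zero, mul_one]
    exact hexp
  have hle := Gamma_one_add_pow_le k hk (u := y - 1) (by linarith)
  rw [show (1 : ℝ) + (y - 1) = y by ring, add_comm] at hle
  have hGk : 0 < Real.Gamma y ^ k := pow_pos hGy k
  calc (Real.Gamma ((k : ℝ) * (y - 1) + 1))⁻¹ ≤ (Real.Gamma y ^ k)⁻¹ := by
        rw [show (k : ℝ) * (y - 1) + 1 = 1 + k * (y - 1) by ring]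
        exact inv_anti₀ hGk (by rw [add_comm]; simpa [add_comm] using hle)
    _ = 1 * (Real.Gamma y)⁻¹ ^ k := by rw [inv_pow, one_mul]
    _ ≤ Real.exp ((y - 1) * Real.log D) * (Real.Gamma y)⁻¹ ^ k := by
        gcongr

/-- … STRICT as soon as `D > 1` (a non-linear member): the beyond-level kernel then carries a positive share of the
predicted mass. [folklore] -/
theorem betaKernelConst_pos_of_one_lt (k : ℕ) {D y : ℝ} (hD : 1 < D) (hy : 1 < y) :
    (Real.Gamma (k * (y - 1) + 1))⁻¹ < Real.exp ((y - 1) * Real.log D) * (Real.Gamma y)⁻¹ ^ k := by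
  have hGy : 0 < Real.Gamma y := Real.Gamma_pos_of_pos (by linarith)
  have hexp : 1 < Real.exp ((y - 1) * Real.log D) :=
    Real.one_lt_exp_iff.2 (mul_pos (by linarith) (Real.log_pos hD))
  have h1 := betaKernelConst_nonneg k (le_refl (1 : ℝ)) hy
  rw [Real.log_one, mul_zero, Real.exp_zero, one_mul] at h1
  have hpos : 0 < (Real.Gamma y)⁻¹ ^ k := pow_pos (inv_pos.2 hGy) k
  calc (Real.Gamma ((k : ℝ) * (y - 1) + 1))⁻¹ ≤ (Real.Gamma y)⁻¹ ^ k := h1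
    _ = 1 * (Real.Gamma y)⁻¹ ^ k := (one_mul _).symm
    _ < Real.exp ((y - 1) * Real.log D) * (Real.Gamma y)⁻¹ ^ k := by gcongr

/-- THE TYPE-I SHARE IS AT MOST ONE: the level-`x` constant `Γ(k(y-1)+1)^{-1}` against the prediction
`D^{y-1}Γ(y)^{-k}` (common factor `λ_f(y)` cancelled). [folklore] -/
theorem typeIShare_le_one (k : ℕ) {D y : ℝ} (hD : 1 ≤ D) (hy : 1 < y) :
    (Real.Gamma (k * (y - 1) + 1))⁻¹ / (Real.exp ((y - 1) * Real.log D) * (Real.Gamma y)⁻¹ ^ k) ≤ 1 := by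
  have hGy : 0 < Real.Gamma y := Real.Gamma_pos_of_pos (by linarith)
  have hden : 0 < Real.exp ((y - 1) * Real.log D) * (Real.Gamma y)⁻¹ ^ k := by positivity
  rw [div_le_one hden]
  exact betaKernelConst_nonneg k hD hy

/-- … and STRICTLY LESS THAN ONE when `D > 1`: for every Bateman–Horn system with a non-linear member a positive share
`1 - Γ(y)^k D^{1-y}/Γ(k(y-1)+1)` of the predicted mass sits in divisor tuples beyond level `x`. [folklore] -/
theorem typeIShare_lt_one (k : ℕ) {D y : ℝ} (hD : 1 < D) (hy : 1 < y) :
    (Real.Gamma (k * (y - 1) + 1))⁻¹ / (Real.exp ((y - 1) * Real.log D) * (Real.Gamma y)⁻¹ ^ k) < 1 := by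
  have hGy : 0 < Real.Gamma y := Real.Gamma_pos_of_pos (by linarith)
  have hden : 0 < Real.exp ((y - 1) * Real.log D) * (Real.Gamma y)⁻¹ ^ k := by positivity
  rw [div_lt_one hden]
  exact betaKernelConst_pos_of_one_lt k hD hy

end Summit.Parity.BatemanHorn.Theorems.SystemLSDRealSegment.Negative
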